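import Literature.MathematicalPhysics.QuantumLattice.FreeFermionSlaterModes
import Literature.MathematicalPhysics.QuantumLattice.HubbardSzSectorLadder
import Literature.MathematicalPhysics.QuantumLattice.DopedRVBState
import HarnessLib

/-!
# The free-fermion sector floor on a finite graph

Topic `MathematicalPhysics/QuantumLattice`, family `hubbard`. For the Hubbard Hamiltonian
`H(U) = hamiltonian G 1 U` on an ARBITRARY finite graph `G` (sites `Λ`, linearly ordered for the
Jordan–Wigner construction) and ANY complete orthonormal family of eigenmodes `v : κ → (Λ → ℂ)` of a
site matrix `A` whose spin doubling is the free one-body matrix (`hubbardOneBody G 1 0 = A ⊗ 1₂`; for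
`A = -adjacency` this is `hubbardOneBody_orb_orb`), with levels `A v_k = ε_k v_k`:

* `IsInSector.create_spinMode_up/down`, `isInSector_slater_spinMode` — the two-spin Slater state
  filling `↑`-modes `l↑` and `↓`-modes `l↓` lies in Lieb's sector `(|l↑|, |l↓|)`, i.e. in the joint
  sector `(N, S^z) = (|l↑| + |l↓|, (|l↑| - |l↓|)/2)` (`mem_szSector_iff_isInSector`);
* `fermiSum_mul_normSq_le_re_rayleigh_hamiltonian` — **the bathtub bound**: for Fermi sets `F↑, F↓`
  (lowest levels, cardinalities `a, b`) and `U ≥ 0`,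
  `(Σ_{F↑} ε + Σ_{F↓} ε) ‖ψ‖² ≤ Re ⟨ψ, H(U) ψ⟩` on the sector `(a, b)`;
* `fermiSea_spec` — the two-spin Fermi sea is a unit vector of the joint sector and an eigenvector
  of `H(0)` with eigenvalue `Σ_{F↑} ε + Σ_{F↓} ε`;
* `minEnergyOn_szSector_hamiltonian_zero_eq_fermiSum` — **the free floor IS the Fermi sum**:
  `minEnergyOn H(0) (szSector (a+b) ((a-b)/2)) = Σ_{F↑} ε + Σ_{F↓} ε`;
  `fermiSum_le_minEnergyOn_szSector_hamiltonian` — the same number bounds the repulsive floor from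
  below (`U ≥ 0`); the `S^z = 0` forms `minEnergyOn_szSector_two_mul_zero_hamiltonian_zero_eq`
  (`= 2 Σ_F ε`) and `two_mul_fermiSum_le_minEnergyOn_szSector_two_mul_zero`;
* `minEnergyOn_szSector_hamiltonian_zero_eq_fermiSum_eigenvalues` — the instance `A = -adjacency`
  with Mathlib's `eigenvectorUnitary` / `eigenvalues`: the free sector floor of any finite graph is
  the species-wise sum of its lowest one-body levels.

This generalises `minEnergyOn_szSector_free_eq` (square torus, plane waves,
`FreeFermionSectorGroundStates.lean`) to every finite graph and every eigenbasis (rectangular and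
twisted tori, ladders, boxes). Everything is proved; no definitions, no named facts. Sources:
J. Bardeen, L. N. Cooper, J. R. Schrieffer, Phys. Rev. 108 (1957) 1175 §II (Fermi seas);
E. H. Lieb, M. Loss, *Analysis* (AMS 2001) Thm 1.14 (bathtub principle); E. H. Lieb, PRL 62 (1989)
1201 (the sectors `(a, b)`). Folklore finite-dimensional statements.

## Mathlib / tree search

Tree (REUSED): part 1 `FreeFermionSlaterModes.lean`; `re_rayleigh_dGamma_eq_sum`,
`normSq_annihilate_mulVec_le`, `sum_fermiSet_le` (abstract bathtub), `re_rayleigh_dGamma_le_hamiltonian`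
(`U ≥ 0`), `hamiltonianWith_zero_eq_dGamma`, `IsInSector.creation_up_mulVec/down`,
`mem_szSector_iff_isInSector`, `szSector_two_mul_zero_eq`, `IsInSector.vacuum`, `minEnergyOn_le_rayleigh_of_mem`,
`hubbardOneBody_orb_orb`, `isHermitian_negAdj`. Mathlib: `le_csInf`,
`Matrix.IsHermitian.mulVec_eigenvectorBasis`, `eigenvectorUnitary_apply`.
-/
namespace Literature.MathematicalPhysics.QuantumLattice

open Matrix Finset Literature.MathematicalPhysics.QuantumLattice.RayleighBound
  Literature.MathematicalPhysics.QuantumLattice.HubbardBandBottom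
open scoped ComplexOrder ComplexConjugate

/-! ### Sector membership of the two-spin Slater state -/

section Spin

variable {Λ : Type*} [LinearOrder Λ] [Fintype Λ] {κ : Type*}

/-- `c†(w_{k↑})` maps Lieb's sector `(a, b)` to `(a + 1, b)`. [folklore] -/
theorem IsInSector.create_spinMode_up (v : κ → Λ → ℂ)
    (w : κ × Fin 2 → Orb Λ → ℂ) (hw : ∀ p o, w p o = if (ofLex o).2 = p.2 then v p.1 (ofLex o).1 else 0)
    {a b : ℕ} {ψ : Fock (Orb Λ)} (hψ : IsInSector a b ψ) (k : κ) :
    IsInSector (a + 1) b (create (w (k, 0)) *ᵥ ψ) := by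
  rw [create_spinMode_eq_sum v w hw, Matrix.sum_mulVec]
  refine Finset.sum_induction _ (IsInSector (a + 1) b) (fun _ _ h₁ h₂ => h₁.add h₂)
    (IsInSector.zero _ _) fun x _ => ?_
  rw [smul_mulVec]
  exact (hψ.creation_up_mulVec x).smul _

/-- `c†(w_{k↓})` maps Lieb's sector `(a, b)` to `(a, b + 1)`. [folklore] -/
theorem IsInSector.create_spinMode_down (v : κ → Λ → ℂ)
    (w : κ × Fin 2 → Orb Λ → ℂ) (hw : ∀ p o, w p o = if (ofLex o).2 = p.2 then v p.1 (ofLex o).1 else 0)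
    {a b : ℕ} {ψ : Fock (Orb Λ)} (hψ : IsInSector a b ψ) (k : κ) :
    IsInSector a (b + 1) (create (w (k, 1)) *ᵥ ψ) := by
  rw [create_spinMode_eq_sum v w hw, Matrix.sum_mulVec]
  refine Finset.sum_induction _ (IsInSector a (b + 1)) (fun _ _ h₁ h₂ => h₁.add h₂)
    (IsInSector.zero _ _) fun x _ => ?_
  rw [smul_mulVec]
  exact (hψ.creation_down_mulVec x).smul _

/-- **The two-spin Slater state lies in Lieb's sector**: filling the `↑`-modes of a list `l↑` on top of
the `↓`-modes of a list `l↓` gives a vector of the sector `(|l↑|, |l↓|)`. [folklore] -/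
theorem isInSector_slater_spinMode (v : κ → Λ → ℂ)
    (w : κ × Fin 2 → Orb Λ → ℂ) (hw : ∀ p o, w p o = if (ofLex o).2 = p.2 then v p.1 (ofLex o).1 else 0)
    (lu ld : List κ) :
    IsInSector lu.length ld.length
      ((List.map (fun p => create (w p))
          (List.map (fun k => Prod.mk k (0 : Fin 2)) lu ++ List.map (fun k => Prod.mk k (1 : Fin 2)) ld)).prod *ᵥ
        (vacuum : Fock (Orb Λ))) := by
  induction lu with
  | nil =>
    rw [List.map_nil, List.nil_append, List.length_nil]
    induction ld with
    | nil =>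
      rw [List.map_nil, List.map_nil, List.prod_nil, one_mulVec, List.length_nil]
      exact IsInSector.vacuum
    | cons k l ih =>
      rw [List.map_cons, List.map_cons, List.prod_cons, ← mulVec_mulVec, List.length_cons]
      exact IsInSector.create_spinMode_down v w hw ih k
  | cons k l ih =>
    rw [List.map_cons, List.cons_append, List.map_cons, List.prod_cons, ← mulVec_mulVec, List.length_cons]
    exact IsInSector.create_spinMode_up v w hw ih k

end Spin

/-! ### The bathtub bound and the free sector floor -/

section Floor

variable {Λ : Type*} [LinearOrder Λ] [Fintype Λ] (G : SimpleGraph Λ) [DecidableRel G.Adj]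
  {κ : Type*} [Fintype κ] [DecidableEq κ]

/-- **The bathtub bound on Lieb's sector `(a, b)`, for repulsion `U ≥ 0`.** Let `v` be a complete
orthonormal family of eigenmodes of a site matrix `A` whose spin doubling is the free one-body
matrix of `G` (`h_{(x,σ),(y,τ)} = [σ = τ] A_{xy}`), with levels `ε`, and let `F↑`, `F↓` be Fermi
sets of `ε` (levels `≤ e_F` inside, `≥ e_F` outside) of cardinalities `a`, `b`. Then
`(Σ_{F↑} ε + Σ_{F↓} ε) ‖ψ‖² ≤ Re ⟨ψ, H(U) ψ⟩` for every `ψ` of the sector `(a, b)`: the repulsion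
is nonnegative and each spin species obeys the bathtub principle (occupations in `[0, 1]` summing to
the species number). Bardeen–Cooper–Schrieffer (1957) §II; Lieb–Loss (2001) Thm 1.14. [folklore] -/
theorem fermiSum_mul_normSq_le_re_rayleigh_hamiltonian {A : Matrix Λ Λ ℂ}
    (hGA : ∀ x σ y τ, hubbardOneBody G 1 0 (orb x σ) (orb y τ) = if σ = τ then A x y else 0)
    (v : κ → Λ → ℂ) (e : κ → ℝ)
    (hv : ∀ x y : Λ, ∑ k, v k x * star (v k y) = if x = y then 1 else 0)
    (hon : ∀ k l, star (v k) ⬝ᵥ v l = if k = l then 1 else 0)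
    (heig : ∀ k, A *ᵥ v k = ((e k : ℝ) : ℂ) • v k)
    (Fu Fd : Finset κ) (eu ed : ℝ)
    (hFu : ∀ k ∈ Fu, e k ≤ eu) (hFu' : ∀ k ∉ Fu, eu ≤ e k)
    (hFd : ∀ k ∈ Fd, e k ≤ ed) (hFd' : ∀ k ∉ Fd, ed ≤ e k)
    {U : ℝ} (hU : 0 ≤ U) {ψ : Fock (Orb Λ)} (hψ : IsInSector Fu.card Fd.card ψ) :
    (∑ k ∈ Fu, e k + ∑ k ∈ Fd, e k) * normSq ψ ≤ (star ψ ⬝ᵥ (hamiltonian G 1 U *ᵥ ψ)).re := by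
  classical
  refine le_trans ?_ (re_rayleigh_dGamma_le_hamiltonian G hU ψ)
  set w : κ × Fin 2 → Orb Λ → ℂ := fun p o => if (ofLex o).2 = p.2 then v p.1 (ofLex o).1 else 0
    with hwdef
  have hw : ∀ p o, w p o = if (ofLex o).2 = p.2 then v p.1 (ofLex o).1 else 0 := fun p o => rfl
  rw [re_rayleigh_dGamma_eq_sum (hubbardOneBody G 1 0) w (fun p => e p.1) (spinMode_complete v hv w hw)
    (spinMode_eigen (hubbardOneBody G 1 0) hGA v e heig w hw) ψ, Fintype.sum_prod_type]
  simp only [Fin.sum_univ_two]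
  rw [Finset.sum_add_distrib]
  have h0 : ∀ p, 0 ≤ normSq (annihilate (w p) *ᵥ ψ) := fun p => normSq_nonneg _
  have h1 : ∀ p, normSq (annihilate (w p) *ᵥ ψ) ≤ normSq ψ := fun p =>
    normSq_annihilate_mulVec_le (spinMode_unit v hon w hw p) ψ
  by_cases hψ0 : normSq ψ = 0
  · have hz : ∀ p, normSq (annihilate (w p) *ᵥ ψ) = 0 := fun p =>
      le_antisymm (hψ0 ▸ h1 p) (h0 p)
    simp only [hz, hψ0, mul_zero, Finset.sum_const_zero, add_zero, le_refl]
  have hpos : 0 < normSq ψ := lt_of_le_of_ne (normSq_nonneg ψ) (Ne.symm hψ0)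
  -- the bathtub bound per spin species, for normalised occupations
  have key : ∀ (F : Finset κ) (eF : ℝ) (σ : Fin 2), (∀ k ∈ F, e k ≤ eF) → (∀ k ∉ F, eF ≤ e k) →
      ∑ k, normSq (annihilate (w (k, σ)) *ᵥ ψ) = F.card * normSq ψ →
      (∑ k ∈ F, e k) * normSq ψ ≤ ∑ k, e k * normSq (annihilate (w (k, σ)) *ᵥ ψ) := by
    intro F eF σ hF hF' hsum
    have h := sum_fermiSet_le e (fun k => normSq (annihilate (w (k, σ)) *ᵥ ψ) / normSq ψ) F eF hF hF'
      (fun k => div_nonneg (h0 _) hpos.le) (fun k => (div_le_one hpos).2 (h1 _))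
      (by rw [← Finset.sum_div, hsum, mul_div_assoc, div_self hψ0, mul_one])
    calc (∑ k ∈ F, e k) * normSq ψ
        ≤ (∑ k, e k * (normSq (annihilate (w (k, σ)) *ᵥ ψ) / normSq ψ)) * normSq ψ :=
          mul_le_mul_of_nonneg_right h hpos.le
      _ = ∑ k, e k * normSq (annihilate (w (k, σ)) *ᵥ ψ) := by
          rw [Finset.sum_mul]
          refine Finset.sum_congr rfl fun k _ => ?_
          rw [mul_assoc, div_mul_cancel₀ _ hψ0]
  exact (add_mul _ _ _).le.trans (add_le_add
    (key Fu eu 0 hFu hFu' (sum_normSq_annihilate_spinMode_up v hv w hw hψ))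
    (key Fd ed 1 hFd hFd' (sum_normSq_annihilate_spinMode_down v hv w hw hψ)))

omit [Fintype κ] in
/-- **The two-spin Fermi sea.** With the data of `fermiSum_mul_normSq_le_re_rayleigh_hamiltonian`
(no Fermi property needed), the Slater state filling the `↑`-modes of `F↑` and the `↓`-modes of `F↓`
lies in the joint sector `(|F↑| + |F↓|, S^z = (|F↑| - |F↓|)/2)`, is a unit vector, and is an
eigenvector of the FREE Hamiltonian `H(0)` with eigenvalue `Σ_{F↑} ε + Σ_{F↓} ε`.
Bardeen–Cooper–Schrieffer (1957) §II. [folklore] -/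
theorem fermiSea_spec {A : Matrix Λ Λ ℂ}
    (hGA : ∀ x σ y τ, hubbardOneBody G 1 0 (orb x σ) (orb y τ) = if σ = τ then A x y else 0)
    (v : κ → Λ → ℂ) (e : κ → ℝ)
    (hon : ∀ k l, star (v k) ⬝ᵥ v l = if k = l then 1 else 0)
    (heig : ∀ k, A *ᵥ v k = ((e k : ℝ) : ℂ) • v k)
    (w : κ × Fin 2 → Orb Λ → ℂ) (hw : ∀ p o, w p o = if (ofLex o).2 = p.2 then v p.1 (ofLex o).1 else 0)
    (Fu Fd : Finset κ) :
    let Φ : Fock (Orb Λ) := (List.map (fun p => create (w p))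
      (List.map (fun k => Prod.mk k (0 : Fin 2)) Fu.toList ++
        List.map (fun k => Prod.mk k (1 : Fin 2)) Fd.toList)).prod *ᵥ vacuum
    Φ ∈ szSector (Fu.card + Fd.card) (((Fu.card : ℝ) - Fd.card) / 2) ∧ star Φ ⬝ᵥ Φ = 1 ∧
      hamiltonian G 1 0 *ᵥ Φ = (((∑ k ∈ Fu, e k + ∑ k ∈ Fd, e k : ℝ)) : ℂ) • Φ := by
  intro Φ
  refine ⟨?_, ?_, ?_⟩
  · rw [mem_szSector_iff_isInSector]
    have h := isInSector_slater_spinMode v w hw Fu.toList Fd.toList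
    rwa [Finset.length_toList, Finset.length_toList] at h
  · refine star_slater_dotProduct_self w (spinMode_orthonormal v hon w hw) ?_
    rw [List.nodup_append']
    refine ⟨Fu.nodup_toList.map fun a b h => (Prod.mk.inj h).1,
      Fd.nodup_toList.map fun a b h => (Prod.mk.inj h).1, fun p hp hp' => ?_⟩
    rw [List.mem_map] at hp hp'
    obtain ⟨k, -, rfl⟩ := hp
    obtain ⟨k', -, hk'⟩ := hp'
    exact absurd (Prod.mk.inj hk').2 (by decide)
  · rw [← hamiltonianWith_zero, hamiltonianWith_zero_eq_dGamma,
      dGamma_mulVec_slater (hubbardOneBody G 1 0) w (fun p => e p.1)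
        (spinMode_eigen (hubbardOneBody G 1 0) hGA v e heig w hw)]
    congr 2
    rw [List.map_append, List.sum_append, List.map_map, List.map_map]
    change (Fu.toList.map e).sum + (Fd.toList.map e).sum = _
    rw [Finset.sum_map_toList, Finset.sum_map_toList]

/-- **The free sector floor IS the Fermi sum.** For the free Hubbard Hamiltonian `H(0)` of a finite
graph, any complete orthonormal eigenbasis `(v_k, ε_k)` of its site matrix and Fermi sets `F↑`, `F↓`
of cardinalities `a`, `b`:
`minEnergyOn H(0) (szSector (a + b) ((a - b)/2)) = Σ_{F↑} ε + Σ_{F↓} ε` (bathtub from below, the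
two-spin Fermi sea from above). Bardeen–Cooper–Schrieffer (1957) §II; Lieb–Loss (2001) Thm 1.14.
[folklore] -/
theorem minEnergyOn_szSector_hamiltonian_zero_eq_fermiSum {A : Matrix Λ Λ ℂ}
    (hGA : ∀ x σ y τ, hubbardOneBody G 1 0 (orb x σ) (orb y τ) = if σ = τ then A x y else 0)
    (v : κ → Λ → ℂ) (e : κ → ℝ)
    (hv : ∀ x y : Λ, ∑ k, v k x * star (v k y) = if x = y then 1 else 0)
    (hon : ∀ k l, star (v k) ⬝ᵥ v l = if k = l then 1 else 0)
    (heig : ∀ k, A *ᵥ v k = ((e k : ℝ) : ℂ) • v k)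
    (Fu Fd : Finset κ) (eu ed : ℝ)
    (hFu : ∀ k ∈ Fu, e k ≤ eu) (hFu' : ∀ k ∉ Fu, eu ≤ e k)
    (hFd : ∀ k ∈ Fd, e k ≤ ed) (hFd' : ∀ k ∉ Fd, ed ≤ e k) :
    (hamiltonian G 1 0).minEnergyOn (szSector (Fu.card + Fd.card) (((Fu.card : ℝ) - Fd.card) / 2)) =
      ∑ k ∈ Fu, e k + ∑ k ∈ Fd, e k := by
  classical
  set w : κ × Fin 2 → Orb Λ → ℂ := fun p o => if (ofLex o).2 = p.2 then v p.1 (ofLex o).1 else 0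
    with hwdef
  have hw : ∀ p o, w p o = if (ofLex o).2 = p.2 then v p.1 (ofLex o).1 else 0 := fun p o => rfl
  obtain ⟨hmem, h1, hH⟩ := fermiSea_spec G hGA v e hon heig w hw Fu Fd
  refine le_antisymm ?_ ?_
  · have h := minEnergyOn_le_rayleigh_of_mem (LiebThm1.hamiltonian_isHermitian G 1 0) _ hmem h1
    rwa [hH, dotProduct_smul, h1, smul_eq_mul, mul_one, Complex.ofReal_re] at h
  · refine le_csInf ⟨_, _, hmem, h1, rfl⟩ ?_
    rintro E ⟨ψ, hψ, hψ1, rfl⟩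
    have hsec := (mem_szSector_iff_isInSector _ _ ψ).1 hψ
    have hn : normSq ψ = 1 := by
      have h := star_dotProduct_self_eq_normSq ψ
      rw [hψ1] at h
      exact_mod_cast h.symm
    have h := fermiSum_mul_normSq_le_re_rayleigh_hamiltonian G hGA v e hv hon heig Fu Fd eu ed hFu hFu'
      hFd hFd' le_rfl hsec
    rwa [hn, mul_one] at h

/-- **The Fermi sum bounds the repulsive sector floor from below**: for `U ≥ 0`,
`Σ_{F↑} ε + Σ_{F↓} ε ≤ minEnergyOn H(U) (szSector (a + b) ((a - b)/2))` (the repulsion is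
nonnegative; the sector is nonempty thanks to the Fermi sea). Lieb–Loss (2001) Thm 1.14. [folklore] -/
theorem fermiSum_le_minEnergyOn_szSector_hamiltonian {A : Matrix Λ Λ ℂ}
    (hGA : ∀ x σ y τ, hubbardOneBody G 1 0 (orb x σ) (orb y τ) = if σ = τ then A x y else 0)
    (v : κ → Λ → ℂ) (e : κ → ℝ)
    (hv : ∀ x y : Λ, ∑ k, v k x * star (v k y) = if x = y then 1 else 0)
    (hon : ∀ k l, star (v k) ⬝ᵥ v l = if k = l then 1 else 0)
    (heig : ∀ k, A *ᵥ v k = ((e k : ℝ) : ℂ) • v k)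
    (Fu Fd : Finset κ) (eu ed : ℝ)
    (hFu : ∀ k ∈ Fu, e k ≤ eu) (hFu' : ∀ k ∉ Fu, eu ≤ e k)
    (hFd : ∀ k ∈ Fd, e k ≤ ed) (hFd' : ∀ k ∉ Fd, ed ≤ e k) {U : ℝ} (hU : 0 ≤ U) :
    ∑ k ∈ Fu, e k + ∑ k ∈ Fd, e k ≤
      (hamiltonian G 1 U).minEnergyOn (szSector (Fu.card + Fd.card) (((Fu.card : ℝ) - Fd.card) / 2)) := by
  classical
  set w : κ × Fin 2 → Orb Λ → ℂ := fun p o => if (ofLex o).2 = p.2 then v p.1 (ofLex o).1 else 0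
    with hwdef
  have hw : ∀ p o, w p o = if (ofLex o).2 = p.2 then v p.1 (ofLex o).1 else 0 := fun p o => rfl
  obtain ⟨hmem, h1, -⟩ := fermiSea_spec G hGA v e hon heig w hw Fu Fd
  refine le_csInf ⟨_, _, hmem, h1, rfl⟩ ?_
  rintro E ⟨ψ, hψ, hψ1, rfl⟩
  have hsec := (mem_szSector_iff_isInSector _ _ ψ).1 hψ
  have hn : normSq ψ = 1 := by
    have h := star_dotProduct_self_eq_normSq ψ
    rw [hψ1] at h
    exact_mod_cast h.symm
  have h := fermiSum_mul_normSq_le_re_rayleigh_hamiltonian G hGA v e hv hon heig Fu Fd eu ed hFu hFu'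
    hFd hFd' hU hsec
  rwa [hn, mul_one] at h

/-- **`S^z = 0` form of the free floor**: `minEnergyOn H(0) (szSector (2n) 0) = 2 Σ_{k ∈ F} ε_k` for a
Fermi set `F` of `n` levels (both species fill `F`). This is `minEnergyOn_szSector_free_eq` of
`FreeFermionSectorGroundStates.lean` for an arbitrary finite graph and eigenbasis.
Bardeen–Cooper–Schrieffer (1957) §II. [folklore] -/
theorem minEnergyOn_szSector_two_mul_zero_hamiltonian_zero_eq {A : Matrix Λ Λ ℂ}
    (hGA : ∀ x σ y τ, hubbardOneBody G 1 0 (orb x σ) (orb y τ) = if σ = τ then A x y else 0)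
    (v : κ → Λ → ℂ) (e : κ → ℝ)
    (hv : ∀ x y : Λ, ∑ k, v k x * star (v k y) = if x = y then 1 else 0)
    (hon : ∀ k l, star (v k) ⬝ᵥ v l = if k = l then 1 else 0)
    (heig : ∀ k, A *ᵥ v k = ((e k : ℝ) : ℂ) • v k)
    (F : Finset κ) (eF : ℝ) (hF : ∀ k ∈ F, e k ≤ eF) (hF' : ∀ k ∉ F, eF ≤ e k) :
    (hamiltonian G 1 0).minEnergyOn (szSector (2 * F.card) 0) = 2 * ∑ k ∈ F, e k := by
  rw [szSector_two_mul_zero_eq, minEnergyOn_szSector_hamiltonian_zero_eq_fermiSum G hGA v e hv hon heig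
    F F eF eF hF hF' hF hF', two_mul]

/-- **`S^z = 0` form of the repulsive lower bound**: for `U ≥ 0`,
`2 Σ_{k ∈ F} ε_k ≤ minEnergyOn H(U) (szSector (2n) 0)`. Lieb–Loss (2001) Thm 1.14. [folklore] -/
theorem two_mul_fermiSum_le_minEnergyOn_szSector_two_mul_zero {A : Matrix Λ Λ ℂ}
    (hGA : ∀ x σ y τ, hubbardOneBody G 1 0 (orb x σ) (orb y τ) = if σ = τ then A x y else 0)
    (v : κ → Λ → ℂ) (e : κ → ℝ)
    (hv : ∀ x y : Λ, ∑ k, v k x * star (v k y) = if x = y then 1 else 0)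
    (hon : ∀ k l, star (v k) ⬝ᵥ v l = if k = l then 1 else 0)
    (heig : ∀ k, A *ᵥ v k = ((e k : ℝ) : ℂ) • v k)
    (F : Finset κ) (eF : ℝ) (hF : ∀ k ∈ F, e k ≤ eF) (hF' : ∀ k ∉ F, eF ≤ e k) {U : ℝ} (hU : 0 ≤ U) :
    2 * ∑ k ∈ F, e k ≤ (hamiltonian G 1 U).minEnergyOn (szSector (2 * F.card) 0) := by
  rw [szSector_two_mul_zero_eq, two_mul]
  exact fermiSum_le_minEnergyOn_szSector_hamiltonian G hGA v e hv hon heig F F eF eF hF hF' hF hF' hU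

/-! ### The spectral-theorem instance: minus the adjacency matrix -/

/-- **The free floor of a finite graph through Mathlib's spectral decomposition.** With
`A = -adjacency(G)` (Hermitian, `isHermitian_negAdj`), its eigenvector unitary `U` and eigenvalues
`λ`, and Fermi sets `F↑, F↓ ⊆ Λ` of the levels `λ`:
`minEnergyOn H(0) (szSector (|F↑| + |F↓|) ((|F↑| - |F↓|)/2)) = Σ_{F↑} λ + Σ_{F↓} λ` — the free
ground-state energy of a sector is the sum of the lowest one-body levels, species by species.
Bardeen–Cooper–Schrieffer (1957) §II. [folklore] -/
theorem minEnergyOn_szSector_hamiltonian_zero_eq_fermiSum_eigenvalues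
    (Fu Fd : Finset Λ) (eu ed : ℝ)
    (hFu : ∀ k ∈ Fu, (isHermitian_negAdj G).eigenvalues k ≤ eu)
    (hFu' : ∀ k ∉ Fu, eu ≤ (isHermitian_negAdj G).eigenvalues k)
    (hFd : ∀ k ∈ Fd, (isHermitian_negAdj G).eigenvalues k ≤ ed)
    (hFd' : ∀ k ∉ Fd, ed ≤ (isHermitian_negAdj G).eigenvalues k) :
    (hamiltonian G 1 0).minEnergyOn (szSector (Fu.card + Fd.card) (((Fu.card : ℝ) - Fd.card) / 2)) =
      ∑ k ∈ Fu, (isHermitian_negAdj G).eigenvalues k + ∑ k ∈ Fd, (isHermitian_negAdj G).eigenvalues k := by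
  classical
  set hA := isHermitian_negAdj G with hAdef
  set U : Matrix Λ Λ ℂ := (hA.eigenvectorUnitary : Matrix Λ Λ ℂ) with hUdef
  have hUU : U * star U = 1 := Matrix.mem_unitaryGroup_iff.1 hA.eigenvectorUnitary.2
  have hUU' : star U * U = 1 := Matrix.mem_unitaryGroup_iff'.1 hA.eigenvectorUnitary.2
  refine minEnergyOn_szSector_hamiltonian_zero_eq_fermiSum G (hubbardOneBody_orb_orb G)
    (fun k x => U x k) hA.eigenvalues (fun x y => ?_) (fun k l => ?_) (fun k => ?_) Fu Fd eu ed hFu hFu'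
    hFd hFd'
  · have h := congrFun (congrFun hUU x) y
    simp only [Matrix.mul_apply, Matrix.star_apply, Matrix.one_apply] at h
    exact h
  · have h := congrFun (congrFun hUU' k) l
    simp only [Matrix.mul_apply, Matrix.star_apply, Matrix.one_apply] at h
    rw [dotProduct]
    simpa only [Pi.star_apply] using h
  · have hcol : (fun x => U x k) = ⇑(hA.eigenvectorBasis k) := by
      funext x; rw [hUdef, Matrix.IsHermitian.eigenvectorUnitary_apply]
    rw [hcol, hA.mulVec_eigenvectorBasis k]
    funext x
    simp only [Pi.smul_apply, Complex.real_smul, smul_eq_mul]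

end Floor

end Literature.MathematicalPhysics.QuantumLattice
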